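import Summits.ABC.IUTFork.Conditional.Layer4OfS
import Summits.ABC.IUTFork.Conditional.Layer4OfSInhabitedV11
import Summits.ABC.IUTFork.DAGC312k
import Summits.ABC.IUTFork.DAGL4a
import Summits.ABC.IUTFork.DAGL4b
import Summits.ABC.IUTFork.DAGL4p
import Summits.ABC.IUTFork.DAGL4q
import Summits.ABC.IUTFork.DAGL4r
import Summits.ABC.IUTFork.DAGL4s
import Summits.ABC.IUTFork.DAGL4t
import Summits.ABC.IUTFork.DAGL4u
import Summits.ABC.IUTFork.DAGL4w
import Summits.ABC.IUTFork.DAGRd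
import Summits.ABC.IUTFork.DAGUm
import Summits.ABC.IUTFork.DAGUn
import Summits.ABC.IUTFork.DAGUo
import Summits.ABC.IUTFork.DAGUu
import Summits.ABC.IUTFork.DAGXj
import Summits.ABC.IUTFork.DAGXk
import Summits.ABC.IUTFork.DAGXn
import Summits.ABC.IUTFork.DAGXq
import HarnessLib

/-!
# L4 layer certificate — KERNEL INHABITATION of the v12 residual (`Layer4Residual12` is a theorem of the index) — companion module V12

abc-iut cell; generator and V0–V3 of record: seat abc-iut-w6-d032 (row CERT-L4); V4–V9 by abc-iut-w6-d071 (gen 3), V10/V11 by abc-iut-c312-2 (gen 6);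
this V12 run by abc-iut-c312-2 (gen 7, kernel-DAG index lineage) on the L4 lead's «GO c312-2 CERT-L4-V12» m123 2026-08-27T01:12:57Z (tools read-only). PROOF-ONLY companion (theorems only; no definition, no instance, no sorry, nothing restated);
a NEW module because `Conditional/Layer4OfSInhabited.lean` (v0–v2 companions, p430828 … p438230) sits at the 400-line cap. Same content and
honest framing as that file: the certificate's KERNEL NOTE made literal for the CURRENT binder — `layer4ResidualA12_inhabited`,
`layer4Residual12_inhabited`, `layer4Cone12_inhabited : Layer4ConeA12 ∧ Layer4ConeB11`, assembled from the index witnesses BY NAME (robust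
superset form: reducible `And.intro` split, each conjunct closed by one of ALL slice-A claim-node witnesses, discharged ones first; part B's
`layer4ResidualB11_inhabited` is imported). CONSEQUENCE for the apex: the L4 binder `(h4 : Layer4Residual12)` CAN be instantiated — the L4
slice carries no open KERNEL obligation at the index level; «r» counts print-coverage NOT yet certified by the L4 lead (plan/L4/NODES.md) and is
untouched by this file. HONEST FRAMING: proves nothing about print; typed ≠ proved-as-printed; indexed ≠ endorsed; inhabited ≠ lead-discharged;
no side taken on [IUTchIII] Cor. 3.12; nothing here says abc is proved or refuted. [claim: Mochizuki2012, status: disputed] (node texts).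
-/

namespace Summit.ABC.IUTFork.Conditional

open Summit.ABC.IUTFork.DAG

universe u₁ u₂ u₃ u₄

/-- `Layer4ResidualA12` is KERNEL-INHABITED (robust form: reducible `And.intro` split; each conjunct closed by an index witness BY NAME from the
superset list of ALL slice-A claim-node witnesses, discharged ones first). Inhabited ≠ lead-discharged. [claim: Mochizuki2012, status: disputed] -/
theorem layer4ResidualA12_inhabited : Layer4ResidualA12.{u₁} := by
  unfold Layer4ResidualA12
  repeat' (with_reducible apply And.intro)
  all_goals first
    | with_reducible exact N_AbsTopIII_Cor1_10_ii_holds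
    | with_reducible exact N_AbsTopIII_Cor2_3_i_holds
    | with_reducible exact N_AbsTopIII_Cor2_4''_holds
    | with_reducible exact N_AbsTopIII_Cor2_7_holds
    | with_reducible exact N_AbsTopIII_Cor2_7_b_r9_holds
    | with_reducible exact N_AbsTopIII_Cor2_7_c_r12_holds
    | with_reducible exact N_AbsTopIII_Cor2_7_c_r16_holds
    | with_reducible exact N_AbsTopIII_Cor3_6_ii_holds
    | with_reducible exact N_AbsTopIII_Cor3_6_iii'_holds
    | with_reducible exact N_AbsTopIII_Cor3_6_iv_holds
    | with_reducible exact N_AbsTopIII_Cor3_6_v'_holds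
    | with_reducible exact N_AbsTopIII_Cor4_5_i_holds
    | with_reducible exact N_AbsTopIII_Cor4_5_ii_holds
    | with_reducible exact N_AbsTopIII_Cor4_5_iii_holds
    | with_reducible exact N_AbsTopIII_Cor4_5_iv_holds
    | with_reducible exact N_AbsTopIII_Cor4_5_v_holds
    | with_reducible exact N_AbsTopIII_Cor5_10_i_holds
    | with_reducible exact N_AbsTopIII_Cor5_10_ii_holds
    | with_reducible exact N_AbsTopIII_Cor5_5_i_part
    | with_reducible exact N_AbsTopIII_Cor5_5_iv'_part
    | with_reducible exact N_AbsTopIII_Cor5_5_v_part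
    | with_reducible exact N_AbsTopIII_Def2_1_i_holds
    | with_reducible exact N_AbsTopIII_Def2_1_ii_holds
    | with_reducible exact N_AbsTopIII_Def2_1_iii_holds
    | with_reducible exact N_AbsTopIII_Def3_1_i_holds
    | with_reducible exact N_AbsTopIII_Def3_1_ii_holds
    | with_reducible exact N_AbsTopIII_Def3_1_iii_holds
    | with_reducible exact N_AbsTopIII_Def3_1_iv_holds
    | with_reducible exact N_AbsTopIII_Def3_1_v_holds
    | with_reducible exact N_AbsTopIII_Def3_1_vi_holds
    | with_reducible exact N_AbsTopIII_Def3_5_i_holds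
    | with_reducible exact N_AbsTopIII_Def3_5_ii_holds
    | with_reducible exact N_AbsTopIII_Def3_5_iii_holds
    | with_reducible exact N_AbsTopIII_Def3_5_iv_holds
    | with_reducible exact N_AbsTopIII_Def3_5_v_holds
    | with_reducible exact N_AbsTopIII_Def3_5_vi_holds
    | with_reducible exact N_AbsTopIII_Def4_1_ii_part
    | with_reducible exact N_AbsTopIII_Def4_1_iii_holds
    | with_reducible exact N_AbsTopIII_Def4_1_iv_holds
    | with_reducible exact N_AbsTopIII_Def5_1_iii_holds
    | with_reducible exact N_AbsTopIII_Def5_1_iv_holds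
    | with_reducible exact N_AbsTopIII_Def5_4_ii_part
    | with_reducible exact N_AbsTopIII_Def5_4_iii_part
    | with_reducible exact N_AbsTopIII_Def5_4_v_part
    | with_reducible exact N_AbsTopIII_Def5_4_vii_part
    | with_reducible exact N_AbsTopIII_Def5_6_i_holds
    | with_reducible exact N_AbsTopIII_Prop1_1_i_holds
    | with_reducible exact N_AbsTopIII_Prop1_3_part
    | with_reducible exact N_AbsTopIII_Prop2_2_ii_holds
    | with_reducible exact N_AbsTopIII_Prop2_5_holds
    | with_reducible exact N_AbsTopIII_Prop2_6_holds
    | with_reducible exact N_AbsTopIII_Prop3_2_ii_holds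
    | with_reducible exact N_AbsTopIII_Prop3_2_iii_holds
    | with_reducible exact N_AbsTopIII_Prop3_2_iv_holds
    | with_reducible exact N_AbsTopIII_Prop3_2_v_holds
    | with_reducible exact N_AbsTopIII_Prop3_3_ii_holds
    | with_reducible exact N_AbsTopIII_Prop4_2_i_holds
    | with_reducible exact N_AbsTopIII_Prop4_2_ii_holds
    | with_reducible exact N_AbsTopIII_Prop5_7_i_holds
    | with_reducible exact N_AbsTopIII_Prop5_7_ii_holds
    | with_reducible exact N_AbsTopIII_Prop5_8_i_holds
    | with_reducible exact N_AbsTopIII_Prop5_8_ii_holds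
    | with_reducible exact N_AbsTopIII_Prop5_8_ii_L01_holds
    | with_reducible exact N_AbsTopIII_Prop5_8_ii_L05a_holds
    | with_reducible exact N_AbsTopIII_Prop5_8_ii_L05b_holds
    | with_reducible exact N_AbsTopIII_Prop5_8_ii_L08_holds
    | with_reducible exact N_AbsTopIII_Prop5_8_iii_holds
    | with_reducible exact N_AbsTopIII_Prop5_8_iv_holds
    | with_reducible exact N_AbsTopIII_Prop5_8_v_holds
    | with_reducible exact N_AbsTopIII_Prop5_8_vi_holds
    | with_reducible exact N_AbsTopIII_Prop5_8_vii'_holds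
    | with_reducible exact N_AbsTopIII_Cor1_10_iii_part
    | with_reducible exact N_AbsTopIII_Cor2_9_holds
    | with_reducible exact N_AbsTopIII_Cor5_10_iv_part
    | with_reducible exact N_AbsTopIII_Cor5_2_i_part
    | with_reducible exact N_AbsTopIII_Cor5_2_iii'_part
    | with_reducible exact N_AbsTopIII_Cor5_2_v_part
    | with_reducible exact N_AbsTopIII_Prop1_4_i'_part
    | with_reducible exact N_AbsTopIII_Prop1_4_ii_part
    | with_reducible exact N_AbsTopIII_Prop1_6_ii_part
    | with_reducible exact N_AbsTopIII_Thm1_9_part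

/-- `Layer4Residual12` (the apex's ONE L4 binder at v12) is KERNEL-INHABITED. Inhabited ≠ lead-discharged. [claim: Mochizuki2012, status: disputed] -/
theorem layer4Residual12_inhabited : Layer4Residual12.{u₁, u₂, u₃} :=
  ⟨layer4ResidualA12_inhabited, layer4ResidualB11_inhabited⟩

/-- The whole L4 slice at v12, AT THE INDEX LEVEL, is a kernel theorem: `Layer4ConeA12 ∧ Layer4ConeB11`. [claim: Mochizuki2012, status: disputed] -/
theorem layer4Cone12_inhabited : Layer4ConeA12.{u₁, u₂, u₃, u₄} ∧ Layer4ConeB11.{u₁, u₂, u₃} :=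
  layer4Cone12_of layer4Residual12_inhabited

end Summit.ABC.IUTFork.Conditional
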